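import Mathlib
import Literature.Computability.AlgebraicComplexity.ArithCircuitProofs
import Literature.Computability.AlgebraicComplexity.IMMInVPProofs
import Summits.ValiantsHypothesis.ValiantsHypothesis.Theorems.DivisionGapTriangularDimersDivisionEasyDefs

/-!
# Crux `DivisionGap.TriangularDimersDivisionEasy` (stmt-ValiantsHypothesis-5067), line `diagonal-spider-shuffling` —
helper file 1 of the registered stub `stub_shufflingDivision` (SHUFFLING GIVES DIVISION)

Toolkit for composing positive local rounds ADDITIVELY in the bihomogeneous normal form
`PMH * Q = P * ∏_{edges} d` (Hrubeš–Yehudayoff 2021 §6; Fomin–Grigoriev–Koshevoy 2014 §1), where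
`PMH = pmSubst E n d` is the generic matching polynomial with every oriented edge variable `x_i`
replaced by a quotient of two fresh variables `n_i / d_i` and denominators cleared:

* positivity over `ℝ≥0` (`eval_pos_of_ne_zero`, `aeval_ne_zero`): non-zero polynomials with
  non-negative coefficients stay non-zero under substitution of non-zero such polynomials;
* `aeval_pmSubst_X`: substituting into `PMH` is `pmSubst` (the substitution is POLYNOMIAL);
* `prod_edges_split`: the oriented pairs `(v, f v)` used by an involution `f` along `E` are exactly
  the edges `i` with `f i.1 = i.2` (reindexing of edge products);
* the BIHOMOGENISATION `num s = ∑_α c_α ∏_j n_j ^ α_j d_j ^ (B - α_j)` of a small item `s` with the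
  common denominator `𝔻 = (∏_j d_j) ^ B`: non-vanishing, circuit size, and the fraction-field
  identity `s(n/d) · 𝔻 = num s` (`theta_num`), plus its list and `pm`/`pmSubst` versions.

No `def` is declared: `num`, `𝔻`, the embedding `ι` into a field and the substitution `θ : x ↦ n/d`
are passed as hypotheses (`hnum`, `h𝔻`, `hθC`, `hθX`).
-/

-- `Summit.ValiantsHypothesis.ValiantsHypothesis.…` is the tree's mandated single-conjunct layout (Sub = Summit).
set_option linter.dupNamespace false

namespace Summit.ValiantsHypothesis.ValiantsHypothesis.Theorems.TriangularDimersDivisionEasy.Shuffling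

open scoped BigOperators NNReal
open Finset MvPolynomial Literature.Computability.AlgebraicComplexity

noncomputable section

namespace Division
/-! ### Helper lemmas for `stub_shufflingDivision` (this stub's private namespace), part 1 -/

/-! #### Positivity over `ℝ≥0` -/

/-- A non-zero polynomial with coefficients in `ℝ≥0` is positive at every positive point. [folklore] -/
theorem eval_pos_of_ne_zero {σ : Type} (q : MvPolynomial σ ℝ≥0) (x : σ → ℝ≥0) (hq : q ≠ 0)
    (hx : ∀ i, 0 < x i) : 0 < eval x q := by
  rw [eval_eq]
  obtain ⟨α, hα⟩ : q.support.Nonempty :=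
    Finset.nonempty_iff_ne_empty.mpr (mt support_eq_empty.mp hq)
  refine Finset.sum_pos' (fun _ _ => _root_.zero_le) ⟨α, hα, ?_⟩
  refine mul_pos ?_ (Finset.prod_pos fun i _ => pow_pos (hx i) _)
  exact pos_iff_ne_zero.mpr (mem_support_iff.mp hα)

/-- Substituting non-zero `ℝ≥0`-polynomials into a non-zero `ℝ≥0`-polynomial gives a non-zero
polynomial (evaluate at the all-ones point). [folklore] -/
theorem aeval_ne_zero {σ ρ : Type} (q : MvPolynomial σ ℝ≥0) (φ : σ → MvPolynomial ρ ℝ≥0)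
    (hq : q ≠ 0) (hφ : ∀ i, φ i ≠ 0) : aeval φ q ≠ 0 := by
  intro h
  have h1 : eval (fun _ => (1 : ℝ≥0)) (aeval φ q) = eval (fun i => eval (fun _ => 1) (φ i)) q := by
    rw [aeval_eq_bind₁]
    exact eval₂Hom_bind₁ _ _ _ _
  have h2 := eval_pos_of_ne_zero q _ hq
    (fun i => eval_pos_of_ne_zero (φ i) (fun _ => 1) (hφ i) (fun _ => one_pos))
  rw [← h1, h, map_zero] at h2
  exact lt_irrefl _ h2

/-- A list of non-zero `ℝ≥0`-polynomials has non-zero product. [folklore] -/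
theorem list_prod_ne_zero {σ : Type} (L : List (MvPolynomial σ ℝ≥0)) (h : ∀ p ∈ L, p ≠ 0) :
    L.prod ≠ 0 :=
  List.prod_ne_zero fun h0 => h 0 h0 rfl

/-! #### Circuit-size bookkeeping -/

/-- `L(∏ L) ≤ |L| · (b + 1)` when every factor has `L ≤ b` (one product gate per factor).
[cite: Burgisser2000, §2.1] -/
theorem complexity_list_prod_le {σ : Type} (L : List (MvPolynomial σ ℝ≥0)) (b : ℕ)
    (h : ∀ p ∈ L, complexity p ≤ b) : complexity L.prod ≤ L.length * (b + 1) := by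
  induction L with
  | nil =>
    rw [List.prod_nil, ← C_1, complexity_C_holds]
    exact Nat.zero_le _
  | cons a L ih =>
    rw [List.prod_cons, List.length_cons]
    have ha := h a (by simp)
    have hL := ih fun p hp => h p (by simp [hp])
    calc complexity (a * L.prod) ≤ complexity a + complexity L.prod + 1 := complexity_mul_le_holds _ _
      _ ≤ b + L.length * (b + 1) + 1 := by gcongr
      _ = (L.length + 1) * (b + 1) := by ring

/-- `L(f ^ m) ≤ m · L(f) + m` (multiply out one factor at a time; as in the tree's
`DivisionGap.complexity_pow_le`, restated here to keep this file's imports minimal).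
[cite: Burgisser2000, §2.1] -/
theorem complexity_pow_le {σ : Type} (f : MvPolynomial σ ℝ≥0) (m : ℕ) :
    complexity (f ^ m) ≤ m * complexity f + m := by
  have h : f ^ m = ∏ _i ∈ Finset.range m, f := by
    rw [Finset.prod_const, Finset.card_range]
  rw [h]
  refine (complexity_finset_prod_le _ _).trans ?_
  rw [Finset.sum_const, Finset.card_range, smul_eq_mul]

/-- A product of variables over a finset `s` costs at most `#s` gates. [cite: Burgisser2000, §2.1] -/
theorem complexity_prod_X_le {σ ι : Type} (s : Finset ι) (v : ι → σ) :
    complexity (∏ i ∈ s, (X (v i) : MvPolynomial σ ℝ≥0)) ≤ s.card := by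
  refine (complexity_finset_prod_le _ _).trans ?_
  have hX : ∀ i : σ, complexity (X i : MvPolynomial σ ℝ≥0) = 0 := complexity_X_holds
  simp only [hX, Finset.sum_const_zero, zero_add, le_refl]

/-- Crude size bound for the bihomogeneous matching polynomial `PMH = pmSubst E n d` on `k` vertices:
at most `k ^ k` involutions, each a product of `k` numerator and `≤ k²` denominator variables.
[folklore] -/
theorem complexity_pmSubst_X_le {k : ℕ} (E : Fin k → Fin k → Bool) :
    complexity (pmSubst E
        (fun i => (X (Sum.inl i) : MvPolynomial ((Fin k × Fin k) ⊕ (Fin k × Fin k)) ℝ≥0))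
        (fun i => X (Sum.inr i))) ≤ k ^ k * (k + k * k + 2) := by
  unfold pmSubst
  refine (complexity_finset_sum_le _ _).trans ?_
  set F := univ.filter (fun f : Fin k → Fin k => ∀ v, f (f v) = v ∧ f v ≠ v ∧ E v (f v) = true)
  have hF : F.card ≤ k ^ k := by
    refine (Finset.card_filter_le _ _).trans ?_
    rw [Finset.card_univ, Fintype.card_fun, Fintype.card_fin]
  have hterm : ∀ f ∈ F, complexity
      ((∏ v : Fin k, (X (Sum.inl (v, f v)) : MvPolynomial ((Fin k × Fin k) ⊕ (Fin k × Fin k)) ℝ≥0)) *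
        ∏ i ∈ univ.filter (fun i : Fin k × Fin k => E i.1 i.2 = true ∧ f i.1 ≠ i.2),
          X (Sum.inr i)) ≤ k + k * k + 1 := by
    intro f _
    refine (complexity_mul_le_holds _ _).trans ?_
    gcongr
    · refine (complexity_prod_X_le _ _).trans ?_
      rw [Finset.card_univ, Fintype.card_fin]
    · refine (complexity_prod_X_le _ _).trans ((Finset.card_filter_le _ _).trans ?_)
      rw [Finset.card_univ, Fintype.card_prod, Fintype.card_fin]
  calc ∑ f ∈ F, _ + F.card ≤ ∑ f ∈ F, (k + k * k + 1) + F.card :=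
        Nat.add_le_add_right (Finset.sum_le_sum hterm) _
    _ = F.card * (k + k * k + 1) + F.card := by rw [Finset.sum_const, smul_eq_mul]
    _ ≤ k ^ k * (k + k * k + 1) + k ^ k := by gcongr
    _ = k ^ k * (k + k * k + 2) := by ring

/-! #### Substitution into the bihomogeneous matching polynomial -/

/-- Substituting `n ↦ φN`, `d ↦ φD` into `PMH = pmSubst E n d` gives `pmSubst E φN φD`: the later
rounds act POLYNOMIALLY on the normal form. [folklore] -/
theorem aeval_pmSubst_X {k : ℕ} (E : Fin k → Fin k → Bool) {ρ : Type}
    (φN φD : Fin k × Fin k → MvPolynomial ρ ℝ≥0) :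
    aeval (Sum.elim φN φD) (pmSubst E
        (fun i => (X (Sum.inl i) : MvPolynomial ((Fin k × Fin k) ⊕ (Fin k × Fin k)) ℝ≥0))
        (fun i => X (Sum.inr i))) = pmSubst E φN φD := by
  unfold pmSubst
  simp only [map_sum, map_mul, map_prod, aeval_X, Sum.elim_inl, Sum.elim_inr]

/-- REINDEXING: for an `E`-valid map `f`, a product over all edges of `E` splits as the product over
the USED oriented pairs `(v, f v)` times the product over the edges unused by `f`. [folklore] -/
theorem prod_edges_split {k : ℕ} (E : Fin k → Fin k → Bool) (f : Fin k → Fin k)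
    (hf : ∀ v, E v (f v) = true) {M : Type} [CommMonoid M] (g : Fin k × Fin k → M) :
    ∏ i ∈ univ.filter (fun i : Fin k × Fin k => E i.1 i.2 = true), g i =
      (∏ v, g (v, f v)) *
        ∏ i ∈ univ.filter (fun i : Fin k × Fin k => E i.1 i.2 = true ∧ f i.1 ≠ i.2), g i := by
  rw [← Finset.prod_filter_mul_prod_filter_not
    (univ.filter fun i : Fin k × Fin k => E i.1 i.2 = true) (fun i => f i.1 = i.2)]
  congr 1
  · have hset : (univ.filter fun i : Fin k × Fin k => E i.1 i.2 = true).filter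
        (fun i => f i.1 = i.2) = univ.map ⟨fun v => (v, f v), fun v w h => (Prod.mk.inj h).1⟩ := by
      ext ⟨v, w⟩
      simp only [Finset.mem_filter, Finset.mem_map, Finset.mem_univ, true_and,
        Function.Embedding.coeFn_mk, Prod.mk.injEq]
      constructor
      · rintro ⟨-, rfl⟩
        exact ⟨v, rfl, rfl⟩
      · rintro ⟨u, rfl, rfl⟩
        exact ⟨hf u, rfl⟩
    rw [hset, Finset.prod_map]
    rfl
  · rw [Finset.filter_filter]

/-! #### Bihomogenisation of small items -/

section Bihom

variable {σ : Type} [Fintype σ] (B : ℕ)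
  (num : MvPolynomial σ ℝ≥0 → MvPolynomial (σ ⊕ σ) ℝ≥0)
  (hnum : ∀ s, num s = ∑ α ∈ s.support, C (coeff α s) *
    ∏ j, ((X (Sum.inl j) : MvPolynomial (σ ⊕ σ) ℝ≥0) ^ (α j) * X (Sum.inr j) ^ (B - α j)))
  (𝔻 : MvPolynomial (σ ⊕ σ) ℝ≥0) (h𝔻 : 𝔻 = (∏ j, (X (Sum.inr j) : MvPolynomial (σ ⊕ σ) ℝ≥0)) ^ B)
include hnum

/-- The bihomogenisation of a non-zero item is non-zero (its value at the all-ones point is the sum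
of the coefficients). [folklore] -/
theorem num_ne_zero (s : MvPolynomial σ ℝ≥0) (hs : s ≠ 0) : num s ≠ 0 := by
  intro h
  have h1 := congrArg (eval (fun _ => (1 : ℝ≥0))) h
  rw [hnum] at h1
  simp only [map_sum, map_mul, eval_C, map_prod, map_pow, eval_X, one_pow, mul_one,
    Finset.prod_const_one, map_zero] at h1
  obtain ⟨α, hα⟩ : s.support.Nonempty :=
    Finset.nonempty_iff_ne_empty.mpr (mt support_eq_empty.mp hs)
  exact mem_support_iff.mp hα (Finset.sum_eq_zero_iff.mp h1 α hα)

/-- Size of the bihomogenisation of a small item: `≤ B · (|σ| · (B + 2) + 2)` gates.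
[cite: Burgisser2000, §2.1] -/
theorem complexity_num_le (s : MvPolynomial σ ℝ≥0) (hs : IsSmall B s) :
    complexity (num s) ≤ B * (Fintype.card σ * (B + 2) + 2) := by
  obtain ⟨-, hdeg, hcard⟩ := hs
  rw [hnum]
  refine (complexity_finset_sum_le _ _).trans ?_
  have hterm : ∀ α ∈ s.support, complexity (C (coeff α s) *
      ∏ j, ((X (Sum.inl j) : MvPolynomial (σ ⊕ σ) ℝ≥0) ^ (α j) * X (Sum.inr j) ^ (B - α j))) ≤
        Fintype.card σ * (B + 2) + 1 := by
    intro α hα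
    refine (complexity_mul_le_holds _ _).trans ?_
    rw [complexity_C_holds, zero_add]
    gcongr
    refine (complexity_finset_prod_le _ _).trans ?_
    have hj : ∀ j ∈ (univ : Finset σ), complexity
        ((X (Sum.inl j) : MvPolynomial (σ ⊕ σ) ℝ≥0) ^ (α j) * X (Sum.inr j) ^ (B - α j)) ≤ B + 1 := by
      intro j _
      refine (complexity_mul_le_holds _ _).trans ?_
      have h1 := complexity_pow_le (X (Sum.inl j) : MvPolynomial (σ ⊕ σ) ℝ≥0) (α j)
      have h2 := complexity_pow_le (X (Sum.inr j) : MvPolynomial (σ ⊕ σ) ℝ≥0) (B - α j)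
      rw [complexity_X_holds, mul_zero, zero_add] at h1 h2
      have hαj : α j ≤ B :=
        (le_degreeOf_of_mem_support j hα).trans ((degreeOf_le_totalDegree s j).trans hdeg)
      omega
    calc ∑ j, _ + (univ : Finset σ).card ≤ ∑ _j ∈ (univ : Finset σ), (B + 1) + (univ : Finset σ).card :=
          Nat.add_le_add_right (Finset.sum_le_sum hj) _
      _ = Fintype.card σ * (B + 2) := by rw [Finset.sum_const, smul_eq_mul, Finset.card_univ]; ring
  calc ∑ α ∈ s.support, _ + s.support.card
      ≤ ∑ _α ∈ s.support, (Fintype.card σ * (B + 2) + 1) + s.support.card :=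
        Nat.add_le_add_right (Finset.sum_le_sum hterm) _
    _ = s.support.card * (Fintype.card σ * (B + 2) + 1) + s.support.card := by
        rw [Finset.sum_const, smul_eq_mul]
    _ ≤ B * (Fintype.card σ * (B + 2) + 1) + B := by gcongr
    _ = B * (Fintype.card σ * (B + 2) + 2) := by ring

omit hnum in
include h𝔻 in
/-- Size of the common denominator `𝔻 = (∏_j d_j) ^ B`: `≤ B · (|σ| + 1)` gates. [cite: Burgisser2000, §2.1] -/
theorem complexity_den_le : complexity 𝔻 ≤ B * (Fintype.card σ + 1) := by
  rw [h𝔻]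
  refine (complexity_pow_le _ _).trans ?_
  have h : complexity (∏ j, (X (Sum.inr j) : MvPolynomial (σ ⊕ σ) ℝ≥0)) ≤ Fintype.card σ :=
    (complexity_prod_X_le _ _).trans (by rw [Finset.card_univ])
  calc B * _ + B ≤ B * Fintype.card σ + B := by gcongr
    _ = B * (Fintype.card σ + 1) := by ring

omit hnum in
include h𝔻 in
/-- The common denominator `𝔻` is non-zero. [folklore] -/
theorem den_ne_zero : 𝔻 ≠ 0 := by
  rw [h𝔻]
  exact pow_ne_zero _ (Finset.prod_ne_zero_iff.mpr fun j _ => X_ne_zero _)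

/-! #### The fraction-field identities of the substitution `x_j ↦ n_j / d_j` -/

variable {K : Type} [Field K] (ι : MvPolynomial (σ ⊕ σ) ℝ≥0 →+* K)
  (θ : MvPolynomial σ ℝ≥0 →+* K) (hθC : ∀ c, θ (C c) = ι (C c))
  (hθX : ∀ j, θ (X j) = ι (X (Sum.inl j)) / ι (X (Sum.inr j)))
  (hι : ∀ j, ι (X (Sum.inr j)) ≠ 0)
include hθC hθX hι h𝔻

/-- BIHOMOGENISATION IDENTITY: for an item `s` all of whose exponents are `≤ B`,
`s(n/d) · 𝔻 = num s` in any field containing `ℝ≥0[n, d]`. [folklore] -/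
theorem theta_num (s : MvPolynomial σ ℝ≥0) (hs : s.totalDegree ≤ B) : θ s * ι 𝔻 = ι (num s) := by
  have hsum : θ s = ∑ α ∈ s.support, θ (monomial α (coeff α s)) := by
    conv_lhs => rw [s.as_sum]
    rw [map_sum]
  rw [hsum, hnum, Finset.sum_mul, map_sum]
  refine Finset.sum_congr rfl fun α hα => ?_
  have hαj : ∀ j, α j ≤ B := fun j =>
    (le_degreeOf_of_mem_support j hα).trans ((degreeOf_le_totalDegree s j).trans hs)
  rw [monomial_eq, map_mul, hθC, Finsupp.prod_fintype _ _ (fun j => pow_zero _), map_prod,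
    map_mul, map_prod, mul_assoc, h𝔻, map_pow, map_prod, ← Finset.prod_pow,
    ← Finset.prod_mul_distrib]
  congr 1
  refine Finset.prod_congr rfl fun j _ => ?_
  rw [map_pow, hθX, map_mul, map_pow, map_pow, div_pow,
    show ι (X (Sum.inr j)) ^ B = ι (X (Sum.inr j)) ^ (α j) * ι (X (Sum.inr j)) ^ (B - α j) by
      rw [← pow_add, Nat.add_sub_cancel' (hαj j)],
    ← mul_assoc, div_mul_cancel₀ _ (pow_ne_zero _ (hι j))]

/-- List version: `(∏ L)(n/d) · 𝔻 ^ |L| = ∏ (L.map num)` for a list of items of degree `≤ B`. [folklore] -/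
theorem theta_list_prod (L : List (MvPolynomial σ ℝ≥0)) (hL : ∀ p ∈ L, p.totalDegree ≤ B) :
    θ L.prod * ι 𝔻 ^ L.length = ι (L.map num).prod := by
  induction L with
  | nil => simp
  | cons a L ih =>
    rw [List.prod_cons, List.length_cons, List.map_cons, List.prod_cons, map_mul, map_mul,
      pow_succ, ← ih (fun p hp => hL p (by simp [hp])),
      ← theta_num B num hnum 𝔻 h𝔻 ι θ hθC hθX hι a (hL a (by simp))]
    ring

end Bihom

section Graph

variable {k' : ℕ} (B : ℕ)
  (num : MvPolynomial (Fin k' × Fin k') ℝ≥0 →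
    MvPolynomial ((Fin k' × Fin k') ⊕ (Fin k' × Fin k')) ℝ≥0)
  (hnum : ∀ s, num s = ∑ α ∈ s.support, C (coeff α s) *
    ∏ j, ((X (Sum.inl j) : MvPolynomial ((Fin k' × Fin k') ⊕ (Fin k' × Fin k')) ℝ≥0) ^ (α j) *
      X (Sum.inr j) ^ (B - α j)))
  (𝔻 : MvPolynomial ((Fin k' × Fin k') ⊕ (Fin k' × Fin k')) ℝ≥0)
  (h𝔻 : 𝔻 = (∏ j, (X (Sum.inr j) : MvPolynomial ((Fin k' × Fin k') ⊕ (Fin k' × Fin k')) ℝ≥0)) ^ B)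
  {K : Type} [Field K] (ι : MvPolynomial ((Fin k' × Fin k') ⊕ (Fin k' × Fin k')) ℝ≥0 →+* K)
  (θ : MvPolynomial (Fin k' × Fin k') ℝ≥0 →+* K) (hθC : ∀ c, θ (C c) = ι (C c))
  (hθX : ∀ j, θ (X j) = ι (X (Sum.inl j)) / ι (X (Sum.inr j)))
  (hι : ∀ j, ι (X (Sum.inr j)) ≠ 0)

include hθX hι in
/-- `pm E'(n/d) · ∏_{edges of E'} d = PMH(E')`: an involution along `E'` uses `k'` distinct edges,
whose denominators cancel. [folklore] -/
theorem theta_pm_mul (E' : Fin k' → Fin k' → Bool) :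
    θ (pm E') * ι (∏ j ∈ univ.filter (fun j : Fin k' × Fin k' => E' j.1 j.2 = true), X (Sum.inr j)) =
      ι (pmSubst E' (fun j => X (Sum.inl j)) (fun j => X (Sum.inr j))) := by
  unfold pm pmSubst
  rw [map_sum, Finset.sum_mul, map_sum]
  refine Finset.sum_congr rfl fun f hf => ?_
  have hfE : ∀ v, E' v (f v) = true := fun v => ((Finset.mem_filter.mp hf).2 v).2.2
  rw [map_prod, map_prod, prod_edges_split E' f hfE, map_mul, map_prod, map_prod]
  simp only [hθX]
  rw [Finset.prod_div_distrib, ← mul_assoc,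
    div_mul_cancel₀ _ (Finset.prod_ne_zero_iff.mpr fun v _ => hι _)]

include hnum h𝔻 hθC hθX hι in
/-- `pmSubst E N D (n/d) · 𝔻 ^ #edges(E) = pmSubst E (num ∘ N) (num ∘ D)`: an involution along `E`
uses `k` items `N` and `#edges(E) - k` items `D`, i.e. `#edges(E)` factors `𝔻` in total. [folklore] -/
theorem theta_pmSubst_mul {k : ℕ} (E : Fin k → Fin k → Bool)
    (N D : Fin k × Fin k → MvPolynomial (Fin k' × Fin k') ℝ≥0)
    (hN : ∀ i, (N i).totalDegree ≤ B) (hD : ∀ i, (D i).totalDegree ≤ B) :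
    θ (pmSubst E N D) * ι 𝔻 ^ (univ.filter (fun i : Fin k × Fin k => E i.1 i.2 = true)).card =
      ι (pmSubst E (fun i => num (N i)) (fun i => num (D i))) := by
  unfold pmSubst
  rw [map_sum, Finset.sum_mul, map_sum]
  refine Finset.sum_congr rfl fun f hf => ?_
  have hfE : ∀ v, E v (f v) = true := fun v => ((Finset.mem_filter.mp hf).2 v).2.2
  rw [← Finset.prod_const, prod_edges_split E f hfE (fun _ => ι 𝔻), map_mul, map_prod, map_prod,
    map_mul, map_prod, map_prod, mul_mul_mul_comm, ← Finset.prod_mul_distrib,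
    ← Finset.prod_mul_distrib]
  congr 1
  · exact Finset.prod_congr rfl fun v _ => theta_num B num hnum 𝔻 h𝔻 ι θ hθC hθX hι _ (hN _)
  · exact Finset.prod_congr rfl fun i _ => theta_num B num hnum 𝔻 h𝔻 ι θ hθC hθX hι _ (hD _)

end Graph


end Division

end

end Summit.ValiantsHypothesis.ValiantsHypothesis.Theorems.TriangularDimersDivisionEasy.Shuffling
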